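import Summits.CriticalPhenomena.PercolationContinuityZ3.Theorems.PercAnnulusCrossingIICTargetScheme
import Summits.CriticalPhenomena.PercolationContinuityZ3.Theorems.PercAnnulusCrossingIICAspectSchemeScales
import Summits.CriticalPhenomena.PercolationContinuityZ3.Theorems.PercAnnulusCrossingIICSchemeSupersolution
import Summits.CriticalPhenomena.PercolationContinuityZ3.Theorems.PercAnnulusCrossingIICTargetTop
import Summits.CriticalPhenomena.PercolationContinuityZ3.Theorems.PercAnnulusCrossingIICAspectExistence
import Summits.CriticalPhenomena.PercolationContinuityZ3.Theorems.PercAnnulusCrossingBoxCrossingDefs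
import Literature.Barriers.CriticalPhenomena.LaceExpansionPcTriangleLargeD
import HarnessLib

/-!
# Kesten's IIC limit does not depend on the conditioning — Basu–Sapozhnikov's Remark 2.1 in kernel form (lane RSW3, p1 gen 4)

builds on p205010 (kernel theorem, internal audit signed; external expert review pending)

Seat `prim-rsw3-p1` (gen 4).  Assembly of the general-target chain (parts IV″–VII″, XIII″, XIV″, XVI″, XVII″, XIX″,
`PercAnnulusCrossingIICTarget*.lean`): the proof of part XX′ verbatim with the two conditionings `{0 ↔ ∂ⁱⁿΛ(n)}`, `{0 ↔ ∂ⁱⁿΛ(n')}`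
replaced by two ADMISSIBLE general conditionings `{0 ↔ T in W}` (finite `W ⊇ Λ(n₀)`, `T ⊆ W ∖ Λ(n₀−1)`, `T` reachable from every site
of `∂ⁱⁿΛ(n₀)` inside `W ∖ Λ(n₀−1)`; e.g. sup-norm spheres, graph-metric (`ℓ¹`) spheres as in the printed theorem, or the boundary of a
finite region containing `Λ(n₀)` whenever it is so reachable).  Helper file; no definitions, no sorries.
* `cond_zero_eq` — `CONN(∅,{0};W,T) = {0 ↔ T in W}`;
* `iic_ratio_condIndep_of_setToSetQM_aspect` — abstract `σ, τ`: `∀ δ > 0 ∃ n₀ ∀` admissible `(W,T), (W',T')`: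
  `|P(E | 0 ↔ T in W) − P(E | 0 ↔ T' in W')| ≤ δ`;
The packaged statements for `SetToSetQuasiMultAspectAt d p s L ϰ` (box limit `ν(E)` + uniform convergence over admissible conditionings)
are in `PercAnnulusCrossingIICTargetLimit.lean` (file-size split).
References: D. Basu, A. Sapozhnikov, ECP 22 (2017) no. 26, Thm. 1.1 and Remark 2.1; H. Kesten, PTRF 73 (1986) Thm. (3).
-/

noncomputable section

namespace Summit.CriticalPhenomena.PercolationContinuityZ3.Theorems.Crossing

open MeasureTheory Literature.Probability.Percolation Literature.Probability.LatticeModels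
open Literature.Probability.Percolation.DCT16
open Summit.CriticalPhenomena.PercolationContinuityZ3.Theorems.SurfaceTension
open scoped Literature.Probability.Percolation
open Filter Topology Literature.Probability.Percolation.DKT20

variable {d : ℕ}

/-- `CONN(∅,{0};W,T)` is the conditioning event `{0 ↔ T in W}`. [folklore] -/
theorem cond_zero_eq (W T : Finset (Site d)) :
    {ω : BondConfig (Site d) | ∃ x ∈ ({0} : Finset (Site d)), ∃ t ∈ T,
          ω ∈ openConnIn ((↑W : Set (Site d)) \ ↑(∅ : Finset (Site d))) x t} =
      {ω | ∃ t ∈ T, ω ∈ openConnIn (↑W : Set (Site d)) 0 t} := by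
  ext ω
  simp only [Set.mem_setOf_eq, Finset.mem_singleton, exists_eq_left, Finset.coe_empty, Set.sdiff_empty]

/-- **Independence of the conditioning (Basu–Sapozhnikov Remark 2.1), abstract `σ, τ` form.**  `d ≥ 1`, `0 < p`, `θ(p) = 0`,
(A2)□(ϰ; σ, τ) with `m < σ m < τ m` monotone.  For every cylinder event `E` and `δ > 0` there is `n₀` such that for ALL pairs of
admissible conditionings `{0 ↔ T in W}`, `{0 ↔ T' in W'}` — finite `W ⊇ Λ(n₀)`, `T ⊆ W ∖ Λ(n₀−1)`, every site of `∂ⁱⁿΛ(n₀)` joined to `T`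
by a lattice walk inside `W ∖ Λ(n₀−1)` — the conditional probabilities of `E` differ by at most `δ`.
[cite: BasuSapozhnikov2017ECP, Remark 2.1 and Thm. 1.1] [cite: Kesten1986, Thm. (3)] -/
theorem iic_ratio_condIndep_of_setToSetQM_aspect (hd : 1 ≤ d) (p : unitInterval) (hp : 0 < (p : ℝ))
    (hθ : theta (zdGraph d) 0 p = 0) {ϰ : ℝ} (hϰ : 0 < ϰ)
    {σ τ : ℕ → ℕ} (hσ : ∀ m : ℕ, 1 ≤ m → m < σ m) (hστ : ∀ m : ℕ, 1 ≤ m → σ m < τ m)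
    (hσm : Monotone σ) (hτm : Monotone τ)
    (hA2 : ∀ m : ℕ, 1 ≤ m → ∀ Z : Finset (Site d), box d (τ m) \ box d (m - 1) ⊆ Z →
      ∀ X : Finset (Site d), X ⊆ Z ∩ box d m → ∀ Y : Finset (Site d), Y ⊆ Z \ box d (τ m) →
        ϰ * (bondPercolation (zdGraph d) p).real {ω | ∃ x ∈ X, ∃ s ∈ innerBoundary (zdGraph d) (box d (σ m)),
              ω ∈ openConnIn (↑Z : Set (Site d)) x s} *
          (bondPercolation (zdGraph d) p).real {ω | ∃ y ∈ Y, ∃ s ∈ innerBoundary (zdGraph d) (box d (σ m)),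
              ω ∈ openConnIn (↑Z : Set (Site d)) y s} ≤
        (bondPercolation (zdGraph d) p).real {ω | ∃ x ∈ X, ∃ y ∈ Y, ω ∈ openConnIn (↑Z : Set (Site d)) x y})
    (F : Finset (Sym2 (Site d))) (E : Set (BondConfig (Site d))) (hEF : DeterminedBy E ↑F) {δ : ℝ} (hδ : 0 < δ) :
    ∃ n₀ : ℕ, 1 ≤ n₀ ∧ ∀ W T W' T' : Finset (Site d),
      box d n₀ ⊆ W → T ⊆ W → (∀ t ∈ T, t ∉ box d (n₀ - 1)) →
      (∀ s ∈ innerBoundary (zdGraph d) (box d n₀), ∃ t ∈ T, ∃ q : (zdGraph d).Walk s t,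
        ∀ z ∈ q.support, z ∈ (↑W : Set (Site d)) \ ↑(box d (n₀ - 1))) →
      box d n₀ ⊆ W' → T' ⊆ W' → (∀ t ∈ T', t ∉ box d (n₀ - 1)) →
      (∀ s ∈ innerBoundary (zdGraph d) (box d n₀), ∃ t ∈ T', ∃ q : (zdGraph d).Walk s t,
        ∀ z ∈ q.support, z ∈ (↑W' : Set (Site d)) \ ↑(box d (n₀ - 1))) →
      |(bondPercolation (zdGraph d) p).real (E ∩ {ω | ∃ t ∈ T, ω ∈ openConnIn (↑W : Set (Site d)) 0 t}) /
          (bondPercolation (zdGraph d) p).real {ω | ∃ t ∈ T, ω ∈ openConnIn (↑W : Set (Site d)) 0 t} -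
        (bondPercolation (zdGraph d) p).real (E ∩ {ω | ∃ t ∈ T', ω ∈ openConnIn (↑W' : Set (Site d)) 0 t}) /
          (bondPercolation (zdGraph d) p).real {ω | ∃ t ∈ T', ω ∈ openConnIn (↑W' : Set (Site d)) 0 t}| ≤ δ := by
  classical
  set μ := bondPercolation (zdGraph d) p with hμ
  -- (A2)□ with `ϰ₀ = min ϰ 1`, product form
  set ϰ₀ : ℝ := min ϰ 1 with hϰ₀
  have hϰ₀0 : 0 < ϰ₀ := lt_min hϰ one_pos
  have hϰ₀1 : ϰ₀ ≤ 1 := min_le_right _ _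
  have hA2' : ∀ m : ℕ, 1 ≤ m → ∀ Z : Finset (Site d), box d (τ m) \ box d (m - 1) ⊆ Z →
      ∀ X : Finset (Site d), X ⊆ Z ∩ box d m → ∀ Y : Finset (Site d), Y ⊆ Z \ box d (τ m) →
        ϰ₀ * (bondPercolation (zdGraph d) p).real {ω | ∃ x ∈ X, ∃ s ∈ innerBoundary (zdGraph d) (box d (σ m)),
              ω ∈ openConnIn (↑Z : Set (Site d)) x s} *
          (bondPercolation (zdGraph d) p).real {ω | ∃ y ∈ Y, ∃ s ∈ innerBoundary (zdGraph d) (box d (σ m)),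
              ω ∈ openConnIn (↑Z : Set (Site d)) y s} ≤
        (bondPercolation (zdGraph d) p).real {ω | ∃ x ∈ X, ∃ y ∈ Y, ω ∈ openConnIn (↑Z : Set (Site d)) x y} := by
    intro m hm Z hZ X hX Y hY
    have h := hA2 m hm Z hZ X hX Y hY
    exact (mul_le_mul_of_nonneg_right (mul_le_mul_of_nonneg_right (min_le_left _ _) measureReal_nonneg) measureReal_nonneg).trans h
  obtain ⟨a₀, ha₀⟩ := exists_box_sym2_superset F
  -- supersolution, junk size, scales
  have hK : (1 : ℝ) ≤ 1 / ϰ₀ ^ 2 := by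
    rw [le_div_iff₀ (by positivity), one_mul]; exact pow_le_one₀ hϰ₀0.le hϰ₀1
  obtain ⟨ε₀, hε₀0, hε₀1, L, hL, hQf⟩ := exists_kesten_supersolution_le hK (show 0 < δ / 4 by positivity)
  set ε : ℝ := min ε₀ (δ / 8) with hε
  have hεpos : 0 < ε := lt_min hε₀0 (by positivity)
  have hεε₀ : ε ≤ ε₀ := min_le_left _ _
  have hεδ : ε ≤ δ / 8 := min_le_right _ _
  have hε1 : ε < 1 := lt_of_le_of_lt hεε₀ hε₀1
  obtain ⟨Q, hQ1, hQ, hQL⟩ := hQf ε hεpos.le hεε₀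
  obtain ⟨M1, M2, μ1, μ2, hMs, hμs, ha₀M⟩ := exists_scheme_scales_aspect p hθ hσ hστ (show 0 < ϰ₀ ^ 2 * ε / 2 by positivity) a₀ L
  have hμ' : ∀ l < L, τ (σ (M2 (l + 1)) + 1) + 2 ≤ σ (μ1 l) ∧ τ (μ1 l) < σ (μ2 l) ∧ μ2 l ≤ M1 l :=
    fun l hl => ⟨(hμs l hl).1, (hμs l hl).2.1, (hμs l hl).2.2.1⟩
  have hjunk' : ∀ l < L, μ.real (boxCrossing d (σ (μ1 l)) (σ (μ2 l))) + μ.real (boxCrossing d (σ (M1 l)) (σ (M2 l))) ≤ ϰ₀ ^ 2 * ε := by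
    intro l hl
    have h1 := (hμs l hl).2.2.2
    have h2 := (hMs l hl.le).2.2.2
    linarith
  have hmono : ∀ l ≤ L, M2 l ≤ M2 0 := by
    intro l hl
    induction l with
    | zero => exact le_rfl
    | succ l ih =>
      obtain ⟨h1, h2, h3, -⟩ := hμs l (by omega)
      obtain ⟨h4, h45, h5, -⟩ := hMs l (by omega)
      obtain ⟨h4', h45', h5', -⟩ := hMs (l + 1) (by omega)
      have a4 := hσ (M2 (l + 1)) (by omega)
      have a5 := hσ (σ (M2 (l + 1)) + 1) (by omega)
      have a6 := hστ (σ (M2 (l + 1)) + 1) (by omega)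
      have a7 : σ (M2 (l + 1)) + 1 < μ1 l := hσm.reflect_lt (by omega)
      have a8 := hστ (μ1 l) (by omega)
      have a9 : μ1 l < μ2 l := hσm.reflect_lt (by omega)
      have : M2 (l + 1) ≤ M2 l := by omega
      exact this.trans (ih (by omega))
  -- `1 ≤ Q L`
  have hQge : ∀ l, 1 ≤ l → 1 ≤ Q l := by
    intro l hl
    induction l with
    | zero => omega
    | succ l ih =>
      rcases Nat.eq_zero_or_pos l with rfl | hl0
      · have h1e : (1 : ℝ) ≤ 1 / (1 - ε) ^ 2 := by
          rw [le_div_iff₀ (by nlinarith), one_mul]; nlinarith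
        have hx : (0 : ℝ) ≤ 1 / ϰ₀ ^ 2 := by positivity
        have he : (1 - ε) ^ 2 ≤ 1 := by nlinarith
        calc (1 : ℝ) ≤ 1 / ϰ₀ ^ 2 := hK
          _ ≤ 1 / ϰ₀ ^ 2 / (1 - ε) ^ 2 := by
              rw [le_div_iff₀ (by nlinarith)]; nlinarith [mul_le_mul_of_nonneg_left he hx]
          _ ≤ Q 1 := hQ1
      · have ih' := ih hl0
        have hstep := hQ l hl0
        have hKinv : 1 / (1 / ϰ₀ ^ 2) = ϰ₀ ^ 2 := by rw [one_div_one_div]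
        rw [hKinv] at hstep
        have hϰ2 : ϰ₀ ^ 2 ≤ 1 := pow_le_one₀ hϰ₀0.le hϰ₀1
        have hnum : 1 ≤ ϰ₀ ^ 2 + (1 - ϰ₀ ^ 2) * Q l := by nlinarith
        have hden : 0 < (1 - ε) ^ 2 := by nlinarith
        have hx0 : 0 ≤ ϰ₀ ^ 2 + (1 - ϰ₀ ^ 2) * Q l := by linarith
        have he : (1 - ε) ^ 2 ≤ 1 := by nlinarith
        have : ϰ₀ ^ 2 + (1 - ϰ₀ ^ 2) * Q l ≤ (ϰ₀ ^ 2 + (1 - ϰ₀ ^ 2) * Q l) / (1 - ε) ^ 2 := by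
          rw [le_div_iff₀ hden]; nlinarith [mul_le_mul_of_nonneg_left he hx0]
        linarith
  -- the main estimate, for two admissible targets at the reference scale `n₀ = τ (M2 0) + 1`
  have main : ∀ W T W' T' : Finset (Site d),
      box d (τ (M2 0) + 1) ⊆ W → T ⊆ W → (∀ t ∈ T, t ∉ box d ((τ (M2 0) + 1) - 1)) →
      (∀ s ∈ innerBoundary (zdGraph d) (box d (τ (M2 0) + 1)), ∃ t ∈ T, ∃ q : (zdGraph d).Walk s t,
        ∀ z ∈ q.support, z ∈ (↑W : Set (Site d)) \ ↑(box d ((τ (M2 0) + 1) - 1))) →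
      box d (τ (M2 0) + 1) ⊆ W' → T' ⊆ W' → (∀ t ∈ T', t ∉ box d ((τ (M2 0) + 1) - 1)) →
      (∀ s ∈ innerBoundary (zdGraph d) (box d (τ (M2 0) + 1)), ∃ t ∈ T', ∃ q : (zdGraph d).Walk s t,
        ∀ z ∈ q.support, z ∈ (↑W' : Set (Site d)) \ ↑(box d ((τ (M2 0) + 1) - 1))) →
      |μ.real (E ∩ {ω : BondConfig (Site d) | ∃ x ∈ ({0} : Finset (Site d)), ∃ t ∈ T,
          ω ∈ openConnIn ((↑W : Set (Site d)) \ ↑(∅ : Finset (Site d))) x t}) / μ.real {ω : BondConfig (Site d) | ∃ x ∈ ({0} : Finset (Site d)), ∃ t ∈ T,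
          ω ∈ openConnIn ((↑W : Set (Site d)) \ ↑(∅ : Finset (Site d))) x t} -
        μ.real (E ∩ {ω : BondConfig (Site d) | ∃ x ∈ ({0} : Finset (Site d)), ∃ t ∈ T',
          ω ∈ openConnIn ((↑W' : Set (Site d)) \ ↑(∅ : Finset (Site d))) x t}) / μ.real {ω : BondConfig (Site d) | ∃ x ∈ ({0} : Finset (Site d)), ∃ t ∈ T',
          ω ∈ openConnIn ((↑W' : Set (Site d)) \ ↑(∅ : Finset (Site d))) x t}| ≤ δ / 2 := by
    intro W T W' T' hW hTW hTn hTr hW' hTW' hTn' hTr'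
    have hM' : ∀ l ≤ L, 1 ≤ M1 l ∧ M1 l ≤ M2 l ∧ τ (M1 l) < σ (M2 l) ∧ τ (M2 l) + 1 ≤ τ (M2 0) + 1 := fun l hl =>
      ⟨(hMs l hl).1, (hMs l hl).2.1, (hMs l hl).2.2.1, Nat.add_le_add_right (hτm (hmono l hl)) 1⟩
    obtain ⟨hML1, hML12, hML2, hML3⟩ := hM' L le_rfl
    have aL1 := hσ (M2 L) (by omega)
    have aL2 := hστ (M2 L) (by omega)
    have hWL : box d (τ (M2 L)) ⊆ W := (box_mono d (by omega)).trans hW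
    have hTbL : ∀ t ∈ T, t ∉ box d (τ (M2 L)) := fun t ht h => hTn t ht (box_mono d (by omega) h)
    have hWL' : box d (τ (M2 L)) ⊆ W' := (box_mono d (by omega)).trans hW'
    have hTbL' : ∀ t ∈ T', t ∉ box d (τ (M2 L)) := fun t ht h => hTn' t ht (box_mono d (by omega) h)
    have hE' : DeterminedBy E (↑((box d (σ (M1 L))).sym2) : Set (Sym2 (Site d))) :=
      hEF.mono (Finset.coe_subset.2 (ha₀.trans (Finset.sym2_mono (box_mono d ha₀M))))
    have hU' : DeterminedBy (Set.univ : Set (BondConfig (Site d))) (↑((box d (σ (M1 L))).sym2) : Set (Sym2 (Site d))) := by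
      rw [determinedBy_iff]; intro ω ω' _; simp
    obtain ⟨hSE1, hSE2⟩ := top_two_sided_target p hϰ₀0 hσ hστ hA2' hML1 hML12 hML2 hWL hTW hTbL hE' subset_rfl
    obtain ⟨hSE1', hSE2'⟩ := top_two_sided_target p hϰ₀0 hσ hστ hA2' hML1 hML12 hML2 hWL' hTW' hTbL' hE' subset_rfl
    obtain ⟨hSU1, hSU2⟩ := top_two_sided_target p hϰ₀0 hσ hστ hA2' hML1 hML12 hML2 hWL hTW hTbL hU' subset_rfl
    obtain ⟨hSU1', hSU2'⟩ := top_two_sided_target p hϰ₀0 hσ hστ hA2' hML1 hML12 hML2 hWL' hTW' hTbL' hU' subset_rfl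
    set 𝒟 := ((box d (σ (M2 L))).powerset.filter (fun U => box d (σ (M1 L)) ⊆ U)) ×ˢ (box d (σ (M2 L) + 1)).powerset with h𝒟
    set SEn := ∑ C ∈ 𝒟, (bondPercolation (zdGraph d) p).real (E ∩
          {ω : BondConfig (Site d) | ω ∩ (↑((box d (σ (M2 L) + 1)).sym2) : Set (Sym2 (Site d))) ∈
            explEvent (↑(box d (σ (M1 L))) : Set (Site d)) ((↑(box d (σ (M2 L))) : Set (Site d)) \ ↑(box d (σ (M1 L)))) ↑C.1 ↑C.2} ∩
          {ω : BondConfig (Site d) | ∀ r ∈ C.2, ∀ r' ∈ C.2, ∃ v ∈ C.1, ∃ v' ∈ C.1,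
            s(v, r) ∈ ω ∧ s(v', r') ∈ ω ∧ ω ∈ openConnIn ((↑C.1 : Set (Site d)) \ ↑(box d (σ (M1 L) - 1))) v v'} ∩
          {ω : BondConfig (Site d) | ∃ x ∈ ({0} : Finset (Site d)), ∃ r ∈ C.2, ∃ v ∈ C.1, ω ∈ openConnIn ((↑C.1 : Set (Site d)) \ ↑(∅ : Finset (Site d))) x v ∧ s(v, r) ∈ ω}) * (bondPercolation (zdGraph d) p).real {ω : BondConfig (Site d) | ∃ x ∈ C.2, ∃ t ∈ T,
            ω ∈ openConnIn ((↑W : Set (Site d)) \ ↑C.1) x t} with hSEn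
    set SEn' := ∑ C ∈ 𝒟, (bondPercolation (zdGraph d) p).real (E ∩
          {ω : BondConfig (Site d) | ω ∩ (↑((box d (σ (M2 L) + 1)).sym2) : Set (Sym2 (Site d))) ∈
            explEvent (↑(box d (σ (M1 L))) : Set (Site d)) ((↑(box d (σ (M2 L))) : Set (Site d)) \ ↑(box d (σ (M1 L)))) ↑C.1 ↑C.2} ∩
          {ω : BondConfig (Site d) | ∀ r ∈ C.2, ∀ r' ∈ C.2, ∃ v ∈ C.1, ∃ v' ∈ C.1,
            s(v, r) ∈ ω ∧ s(v', r') ∈ ω ∧ ω ∈ openConnIn ((↑C.1 : Set (Site d)) \ ↑(box d (σ (M1 L) - 1))) v v'} ∩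
          {ω : BondConfig (Site d) | ∃ x ∈ ({0} : Finset (Site d)), ∃ r ∈ C.2, ∃ v ∈ C.1, ω ∈ openConnIn ((↑C.1 : Set (Site d)) \ ↑(∅ : Finset (Site d))) x v ∧ s(v, r) ∈ ω}) * (bondPercolation (zdGraph d) p).real {ω : BondConfig (Site d) | ∃ x ∈ C.2, ∃ t ∈ T',
            ω ∈ openConnIn ((↑W' : Set (Site d)) \ ↑C.1) x t} with hSEn'
    set SUn := ∑ C ∈ 𝒟, (bondPercolation (zdGraph d) p).real (Set.univ ∩
          {ω : BondConfig (Site d) | ω ∩ (↑((box d (σ (M2 L) + 1)).sym2) : Set (Sym2 (Site d))) ∈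
            explEvent (↑(box d (σ (M1 L))) : Set (Site d)) ((↑(box d (σ (M2 L))) : Set (Site d)) \ ↑(box d (σ (M1 L)))) ↑C.1 ↑C.2} ∩
          {ω : BondConfig (Site d) | ∀ r ∈ C.2, ∀ r' ∈ C.2, ∃ v ∈ C.1, ∃ v' ∈ C.1,
            s(v, r) ∈ ω ∧ s(v', r') ∈ ω ∧ ω ∈ openConnIn ((↑C.1 : Set (Site d)) \ ↑(box d (σ (M1 L) - 1))) v v'} ∩
          {ω : BondConfig (Site d) | ∃ x ∈ ({0} : Finset (Site d)), ∃ r ∈ C.2, ∃ v ∈ C.1, ω ∈ openConnIn ((↑C.1 : Set (Site d)) \ ↑(∅ : Finset (Site d))) x v ∧ s(v, r) ∈ ω}) * (bondPercolation (zdGraph d) p).real {ω : BondConfig (Site d) | ∃ x ∈ C.2, ∃ t ∈ T,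
            ω ∈ openConnIn ((↑W : Set (Site d)) \ ↑C.1) x t} with hSUn
    set SUn' := ∑ C ∈ 𝒟, (bondPercolation (zdGraph d) p).real (Set.univ ∩
          {ω : BondConfig (Site d) | ω ∩ (↑((box d (σ (M2 L) + 1)).sym2) : Set (Sym2 (Site d))) ∈
            explEvent (↑(box d (σ (M1 L))) : Set (Site d)) ((↑(box d (σ (M2 L))) : Set (Site d)) \ ↑(box d (σ (M1 L)))) ↑C.1 ↑C.2} ∩
          {ω : BondConfig (Site d) | ∀ r ∈ C.2, ∀ r' ∈ C.2, ∃ v ∈ C.1, ∃ v' ∈ C.1,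
            s(v, r) ∈ ω ∧ s(v', r') ∈ ω ∧ ω ∈ openConnIn ((↑C.1 : Set (Site d)) \ ↑(box d (σ (M1 L) - 1))) v v'} ∩
          {ω : BondConfig (Site d) | ∃ x ∈ ({0} : Finset (Site d)), ∃ r ∈ C.2, ∃ v ∈ C.1, ω ∈ openConnIn ((↑C.1 : Set (Site d)) \ ↑(∅ : Finset (Site d))) x v ∧ s(v, r) ∈ ω}) * (bondPercolation (zdGraph d) p).real {ω : BondConfig (Site d) | ∃ x ∈ C.2, ∃ t ∈ T',
            ω ∈ openConnIn ((↑W' : Set (Site d)) \ ↑C.1) x t} with hSUn'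
    -- junk of the top level
    have hπ0 : 0 < μ.real {ω : BondConfig (Site d) | ∃ x ∈ ({0} : Finset (Site d)),
        ∃ t ∈ innerBoundary (zdGraph d) (box d (τ (M2 0) + 1)),
          ω ∈ openConnIn ((↑(box d (τ (M2 0) + 1)) : Set (Site d)) \ ↑(∅ : Finset (Site d))) x t} := by
      rw [conn_empty_zero_eq]; exact oneArmProb_pos hd p hp _
    have hπn : 0 < μ.real {ω : BondConfig (Site d) | ∃ x ∈ ({0} : Finset (Site d)), ∃ t ∈ T,
          ω ∈ openConnIn ((↑W : Set (Site d)) \ ↑(∅ : Finset (Site d))) x t} :=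
      real_conn_target_pos_of_real_conn_pos p hp (b := 0) (by omega) (Finset.empty_subset _) hW hTr hπ0
    have hπn' : 0 < μ.real {ω : BondConfig (Site d) | ∃ x ∈ ({0} : Finset (Site d)), ∃ t ∈ T',
          ω ∈ openConnIn ((↑W' : Set (Site d)) \ ↑(∅ : Finset (Site d))) x t} :=
      real_conn_target_pos_of_real_conn_pos p hp (b := 0) (by omega) (Finset.empty_subset _) hW' hTr' hπ0
    rw [Set.univ_inter] at hSU1 hSU2 hSU1' hSU2'
    have hη : ϰ₀⁻¹ ^ 2 * μ.real (boxCrossing d (σ (M1 L)) (σ (M2 L))) ≤ ε := by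
      have h2 := (hMs L le_rfl).2.2.2
      rw [inv_pow, inv_mul_le_iff₀ (by positivity : (0 : ℝ) < ϰ₀ ^ 2)]
      have : 0 ≤ ϰ₀ ^ 2 * ε := by positivity
      linarith
    -- membership facts for the top data
    have hfacts : ∀ C ∈ 𝒟, C.1 ⊆ box d (σ (M2 L)) ∧
        (bondPercolation (zdGraph d) p).real (Set.univ ∩
          {ω : BondConfig (Site d) | ω ∩ (↑((box d (σ (M2 L) + 1)).sym2) : Set (Sym2 (Site d))) ∈
            explEvent (↑(box d (σ (M1 L))) : Set (Site d)) ((↑(box d (σ (M2 L))) : Set (Site d)) \ ↑(box d (σ (M1 L)))) ↑C.1 ↑C.2} ∩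
          {ω : BondConfig (Site d) | ∀ r ∈ C.2, ∀ r' ∈ C.2, ∃ v ∈ C.1, ∃ v' ∈ C.1,
            s(v, r) ∈ ω ∧ s(v', r') ∈ ω ∧ ω ∈ openConnIn ((↑C.1 : Set (Site d)) \ ↑(box d (σ (M1 L) - 1))) v v'} ∩
          {ω : BondConfig (Site d) | ∃ x ∈ ({0} : Finset (Site d)), ∃ r ∈ C.2, ∃ v ∈ C.1, ω ∈ openConnIn ((↑C.1 : Set (Site d)) \ ↑(∅ : Finset (Site d))) x v ∧ s(v, r) ∈ ω}) ≤ (bondPercolation (zdGraph d) p).real {ω : BondConfig (Site d) | ω ∩ (↑((box d (σ (M2 L) + 1)).sym2) : Set (Sym2 (Site d))) ∈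
            explEvent (↑(box d (σ (M1 L))) : Set (Site d)) ((↑(box d (σ (M2 L))) : Set (Site d)) \ ↑(box d (σ (M1 L)))) ↑C.1 ↑C.2} := by
      intro C hC
      rw [h𝒟, Finset.mem_product, Finset.mem_filter, Finset.mem_powerset] at hC
      exact ⟨hC.1.1, measureReal_mono (fun ω h => h.1.1.2) (measure_ne_top _ _)⟩
    have hwle : ∀ C ∈ 𝒟, (bondPercolation (zdGraph d) p).real (E ∩
          {ω : BondConfig (Site d) | ω ∩ (↑((box d (σ (M2 L) + 1)).sym2) : Set (Sym2 (Site d))) ∈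
            explEvent (↑(box d (σ (M1 L))) : Set (Site d)) ((↑(box d (σ (M2 L))) : Set (Site d)) \ ↑(box d (σ (M1 L)))) ↑C.1 ↑C.2} ∩
          {ω : BondConfig (Site d) | ∀ r ∈ C.2, ∀ r' ∈ C.2, ∃ v ∈ C.1, ∃ v' ∈ C.1,
            s(v, r) ∈ ω ∧ s(v', r') ∈ ω ∧ ω ∈ openConnIn ((↑C.1 : Set (Site d)) \ ↑(box d (σ (M1 L) - 1))) v v'} ∩
          {ω : BondConfig (Site d) | ∃ x ∈ ({0} : Finset (Site d)), ∃ r ∈ C.2, ∃ v ∈ C.1, ω ∈ openConnIn ((↑C.1 : Set (Site d)) \ ↑(∅ : Finset (Site d))) x v ∧ s(v, r) ∈ ω}) ≤ (bondPercolation (zdGraph d) p).real (Set.univ ∩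
          {ω : BondConfig (Site d) | ω ∩ (↑((box d (σ (M2 L) + 1)).sym2) : Set (Sym2 (Site d))) ∈
            explEvent (↑(box d (σ (M1 L))) : Set (Site d)) ((↑(box d (σ (M2 L))) : Set (Site d)) \ ↑(box d (σ (M1 L)))) ↑C.1 ↑C.2} ∩
          {ω : BondConfig (Site d) | ∀ r ∈ C.2, ∀ r' ∈ C.2, ∃ v ∈ C.1, ∃ v' ∈ C.1,
            s(v, r) ∈ ω ∧ s(v', r') ∈ ω ∧ ω ∈ openConnIn ((↑C.1 : Set (Site d)) \ ↑(box d (σ (M1 L) - 1))) v v'} ∩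
          {ω : BondConfig (Site d) | ∃ x ∈ ({0} : Finset (Site d)), ∃ r ∈ C.2, ∃ v ∈ C.1, ω ∈ openConnIn ((↑C.1 : Set (Site d)) \ ↑(∅ : Finset (Site d))) x v ∧ s(v, r) ∈ ω}) := fun C _ =>
      measureReal_mono (Set.inter_subset_inter_left _ (Set.inter_subset_inter_left _
        (Set.inter_subset_inter_left _ (Set.subset_univ E)))) (measure_ne_top _ _)
    -- positivity: general target ⇄ reference box target `τ (M2 0) + 1`
    have href : ∀ C ∈ 𝒟, ∀ (W₁ T₁ : Finset (Site d)), (∀ t ∈ T₁, t ∉ box d (τ (M2 0) + 1 - 1)) →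
        0 < (bondPercolation (zdGraph d) p).real {ω : BondConfig (Site d) | ∃ x ∈ C.2, ∃ t ∈ T₁,
            ω ∈ openConnIn ((↑W₁ : Set (Site d)) \ ↑C.1) x t} →
        0 < (bondPercolation (zdGraph d) p).real {ω : BondConfig (Site d) | ∃ x ∈ C.2,
            ∃ t ∈ innerBoundary (zdGraph d) (box d (τ (M2 0) + 1)),
            ω ∈ openConnIn ((↑(box d (τ (M2 0) + 1)) : Set (Site d)) \ ↑C.1) x t} := by
      intro C hC W₁ T₁ hT₁ h
      rw [h𝒟, Finset.mem_product, Finset.mem_powerset] at hC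
      exact lt_of_lt_of_le h (real_conn_target_le_real_conn p (by omega) (hC.2.trans (box_mono d (by omega))) hT₁)
    have htoT : ∀ C ∈ 𝒟, 0 < (bondPercolation (zdGraph d) p).real {ω : BondConfig (Site d) | ∃ x ∈ C.2,
            ∃ t ∈ innerBoundary (zdGraph d) (box d (τ (M2 0) + 1)),
            ω ∈ openConnIn ((↑(box d (τ (M2 0) + 1)) : Set (Site d)) \ ↑C.1) x t} →
        0 < (bondPercolation (zdGraph d) p).real {ω : BondConfig (Site d) | ∃ x ∈ C.2, ∃ t ∈ T,
            ω ∈ openConnIn ((↑W : Set (Site d)) \ ↑C.1) x t} := fun C hC h =>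
      real_conn_target_pos_of_real_conn_pos p hp (b := σ (M2 L)) (by omega) (hfacts C hC).1 hW hTr h
    have htoT' : ∀ C ∈ 𝒟, 0 < (bondPercolation (zdGraph d) p).real {ω : BondConfig (Site d) | ∃ x ∈ C.2,
            ∃ t ∈ innerBoundary (zdGraph d) (box d (τ (M2 0) + 1)),
            ω ∈ openConnIn ((↑(box d (τ (M2 0) + 1)) : Set (Site d)) \ ↑C.1) x t} →
        0 < (bondPercolation (zdGraph d) p).real {ω : BondConfig (Site d) | ∃ x ∈ C.2, ∃ t ∈ T',
            ω ∈ openConnIn ((↑W' : Set (Site d)) \ ↑C.1) x t} := fun C hC h =>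
      real_conn_target_pos_of_real_conn_pos p hp (b := σ (M2 L)) (by omega) (hfacts C hC).1 hW' hTr' h
    -- the cross inequalities from the oscillation bound
    have hosc : ∀ C ∈ 𝒟, ∀ C' ∈ 𝒟, 0 < (bondPercolation (zdGraph d) p).real (Set.univ ∩
          {ω : BondConfig (Site d) | ω ∩ (↑((box d (σ (M2 L) + 1)).sym2) : Set (Sym2 (Site d))) ∈
            explEvent (↑(box d (σ (M1 L))) : Set (Site d)) ((↑(box d (σ (M2 L))) : Set (Site d)) \ ↑(box d (σ (M1 L)))) ↑C.1 ↑C.2} ∩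
          {ω : BondConfig (Site d) | ∀ r ∈ C.2, ∀ r' ∈ C.2, ∃ v ∈ C.1, ∃ v' ∈ C.1,
            s(v, r) ∈ ω ∧ s(v', r') ∈ ω ∧ ω ∈ openConnIn ((↑C.1 : Set (Site d)) \ ↑(box d (σ (M1 L) - 1))) v v'} ∩
          {ω : BondConfig (Site d) | ∃ x ∈ ({0} : Finset (Site d)), ∃ r ∈ C.2, ∃ v ∈ C.1, ω ∈ openConnIn ((↑C.1 : Set (Site d)) \ ↑(∅ : Finset (Site d))) x v ∧ s(v, r) ∈ ω}) →
        0 < (bondPercolation (zdGraph d) p).real (Set.univ ∩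
          {ω : BondConfig (Site d) | ω ∩ (↑((box d (σ (M2 L) + 1)).sym2) : Set (Sym2 (Site d))) ∈
            explEvent (↑(box d (σ (M1 L))) : Set (Site d)) ((↑(box d (σ (M2 L))) : Set (Site d)) \ ↑(box d (σ (M1 L)))) ↑C'.1 ↑C'.2} ∩
          {ω : BondConfig (Site d) | ∀ r ∈ C'.2, ∀ r' ∈ C'.2, ∃ v ∈ C'.1, ∃ v' ∈ C'.1,
            s(v, r) ∈ ω ∧ s(v', r') ∈ ω ∧ ω ∈ openConnIn ((↑C'.1 : Set (Site d)) \ ↑(box d (σ (M1 L) - 1))) v v'} ∩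
          {ω : BondConfig (Site d) | ∃ x ∈ ({0} : Finset (Site d)), ∃ r ∈ C'.2, ∃ v ∈ C'.1, ω ∈ openConnIn ((↑C'.1 : Set (Site d)) \ ↑(∅ : Finset (Site d))) x v ∧ s(v, r) ∈ ω}) →
        0 < (bondPercolation (zdGraph d) p).real {ω : BondConfig (Site d) | ∃ x ∈ C.2, ∃ t ∈ T,
            ω ∈ openConnIn ((↑W : Set (Site d)) \ ↑C.1) x t} → 0 < (bondPercolation (zdGraph d) p).real {ω : BondConfig (Site d) | ∃ x ∈ C'.2, ∃ t ∈ T,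
            ω ∈ openConnIn ((↑W : Set (Site d)) \ ↑C'.1) x t} →
        (bondPercolation (zdGraph d) p).real {ω : BondConfig (Site d) | ∃ x ∈ C.2, ∃ t ∈ T,
            ω ∈ openConnIn ((↑W : Set (Site d)) \ ↑C.1) x t} * (bondPercolation (zdGraph d) p).real {ω : BondConfig (Site d) | ∃ x ∈ C'.2, ∃ t ∈ T',
            ω ∈ openConnIn ((↑W' : Set (Site d)) \ ↑C'.1) x t} ≤
          Q L * ((bondPercolation (zdGraph d) p).real {ω : BondConfig (Site d) | ∃ x ∈ C'.2, ∃ t ∈ T,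
            ω ∈ openConnIn ((↑W : Set (Site d)) \ ↑C'.1) x t} * (bondPercolation (zdGraph d) p).real {ω : BondConfig (Site d) | ∃ x ∈ C.2, ∃ t ∈ T',
            ω ∈ openConnIn ((↑W' : Set (Site d)) \ ↑C.1) x t}) := by
      intro C hC C' hC' hwC hwC' hγC hγC'
      exact conn_ratio_osc_le_target p hp hϰ₀0 hϰ₀1 hσ hστ hσm hτm hA2' hL hM' hW hTW hTn hTr hW' hTW' hTn' hTr' hμ' hjunk' hεpos.le
        hε1 Q hQ1 hQ hC hC' (href C hC W T hTn hγC) (lt_of_lt_of_le hwC (hfacts C hC).2) (href C' hC' W T hTn hγC')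
        (lt_of_lt_of_le hwC' (hfacts C' hC').2)
    have htransfer : ∀ C ∈ 𝒟, 0 < (bondPercolation (zdGraph d) p).real {ω : BondConfig (Site d) | ∃ x ∈ C.2, ∃ t ∈ T',
            ω ∈ openConnIn ((↑W' : Set (Site d)) \ ↑C.1) x t} → 0 < (bondPercolation (zdGraph d) p).real {ω : BondConfig (Site d) | ∃ x ∈ C.2, ∃ t ∈ T,
            ω ∈ openConnIn ((↑W : Set (Site d)) \ ↑C.1) x t} := fun C hC h =>
      htoT C hC (href C hC W' T' hTn' h)
    have htransfer' : ∀ C ∈ 𝒟, 0 < (bondPercolation (zdGraph d) p).real {ω : BondConfig (Site d) | ∃ x ∈ C.2, ∃ t ∈ T,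
            ω ∈ openConnIn ((↑W : Set (Site d)) \ ↑C.1) x t} → 0 < (bondPercolation (zdGraph d) p).real {ω : BondConfig (Site d) | ∃ x ∈ C.2, ∃ t ∈ T',
            ω ∈ openConnIn ((↑W' : Set (Site d)) \ ↑C.1) x t} := fun C hC h =>
      htoT' C hC (href C hC W T hTn h)
    have hQ0 : 0 ≤ Q L := zero_le_one.trans (hQge L hL)
    have hx1 : SEn * SUn' ≤ Q L * (SEn' * SUn) :=
      sum_mul_sum_le_of_osc 𝒟 (f := fun C => (bondPercolation (zdGraph d) p).real (E ∩
          {ω : BondConfig (Site d) | ω ∩ (↑((box d (σ (M2 L) + 1)).sym2) : Set (Sym2 (Site d))) ∈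
            explEvent (↑(box d (σ (M1 L))) : Set (Site d)) ((↑(box d (σ (M2 L))) : Set (Site d)) \ ↑(box d (σ (M1 L)))) ↑C.1 ↑C.2} ∩
          {ω : BondConfig (Site d) | ∀ r ∈ C.2, ∀ r' ∈ C.2, ∃ v ∈ C.1, ∃ v' ∈ C.1,
            s(v, r) ∈ ω ∧ s(v', r') ∈ ω ∧ ω ∈ openConnIn ((↑C.1 : Set (Site d)) \ ↑(box d (σ (M1 L) - 1))) v v'} ∩
          {ω : BondConfig (Site d) | ∃ x ∈ ({0} : Finset (Site d)), ∃ r ∈ C.2, ∃ v ∈ C.1, ω ∈ openConnIn ((↑C.1 : Set (Site d)) \ ↑(∅ : Finset (Site d))) x v ∧ s(v, r) ∈ ω}))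
        (g := fun C => (bondPercolation (zdGraph d) p).real (Set.univ ∩
          {ω : BondConfig (Site d) | ω ∩ (↑((box d (σ (M2 L) + 1)).sym2) : Set (Sym2 (Site d))) ∈
            explEvent (↑(box d (σ (M1 L))) : Set (Site d)) ((↑(box d (σ (M2 L))) : Set (Site d)) \ ↑(box d (σ (M1 L)))) ↑C.1 ↑C.2} ∩
          {ω : BondConfig (Site d) | ∀ r ∈ C.2, ∀ r' ∈ C.2, ∃ v ∈ C.1, ∃ v' ∈ C.1,
            s(v, r) ∈ ω ∧ s(v', r') ∈ ω ∧ ω ∈ openConnIn ((↑C.1 : Set (Site d)) \ ↑(box d (σ (M1 L) - 1))) v v'} ∩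
          {ω : BondConfig (Site d) | ∃ x ∈ ({0} : Finset (Site d)), ∃ r ∈ C.2, ∃ v ∈ C.1, ω ∈ openConnIn ((↑C.1 : Set (Site d)) \ ↑(∅ : Finset (Site d))) x v ∧ s(v, r) ∈ ω}))
        (u := fun C => (bondPercolation (zdGraph d) p).real {ω : BondConfig (Site d) | ∃ x ∈ C.2, ∃ t ∈ T,
            ω ∈ openConnIn ((↑W : Set (Site d)) \ ↑C.1) x t})
        (v := fun C => (bondPercolation (zdGraph d) p).real {ω : BondConfig (Site d) | ∃ x ∈ C.2, ∃ t ∈ T',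
            ω ∈ openConnIn ((↑W' : Set (Site d)) \ ↑C.1) x t})
        hQ0 (fun C _ => measureReal_nonneg) hwle (fun C _ => measureReal_nonneg) (fun C _ => measureReal_nonneg)
        (fun C hC _ h => htransfer C hC h) hosc
    have hx2 : SEn' * SUn ≤ Q L * (SEn * SUn') :=
      sum_mul_sum_le_of_osc 𝒟 (f := fun C => (bondPercolation (zdGraph d) p).real (E ∩
          {ω : BondConfig (Site d) | ω ∩ (↑((box d (σ (M2 L) + 1)).sym2) : Set (Sym2 (Site d))) ∈
            explEvent (↑(box d (σ (M1 L))) : Set (Site d)) ((↑(box d (σ (M2 L))) : Set (Site d)) \ ↑(box d (σ (M1 L)))) ↑C.1 ↑C.2} ∩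
          {ω : BondConfig (Site d) | ∀ r ∈ C.2, ∀ r' ∈ C.2, ∃ v ∈ C.1, ∃ v' ∈ C.1,
            s(v, r) ∈ ω ∧ s(v', r') ∈ ω ∧ ω ∈ openConnIn ((↑C.1 : Set (Site d)) \ ↑(box d (σ (M1 L) - 1))) v v'} ∩
          {ω : BondConfig (Site d) | ∃ x ∈ ({0} : Finset (Site d)), ∃ r ∈ C.2, ∃ v ∈ C.1, ω ∈ openConnIn ((↑C.1 : Set (Site d)) \ ↑(∅ : Finset (Site d))) x v ∧ s(v, r) ∈ ω}))
        (g := fun C => (bondPercolation (zdGraph d) p).real (Set.univ ∩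
          {ω : BondConfig (Site d) | ω ∩ (↑((box d (σ (M2 L) + 1)).sym2) : Set (Sym2 (Site d))) ∈
            explEvent (↑(box d (σ (M1 L))) : Set (Site d)) ((↑(box d (σ (M2 L))) : Set (Site d)) \ ↑(box d (σ (M1 L)))) ↑C.1 ↑C.2} ∩
          {ω : BondConfig (Site d) | ∀ r ∈ C.2, ∀ r' ∈ C.2, ∃ v ∈ C.1, ∃ v' ∈ C.1,
            s(v, r) ∈ ω ∧ s(v', r') ∈ ω ∧ ω ∈ openConnIn ((↑C.1 : Set (Site d)) \ ↑(box d (σ (M1 L) - 1))) v v'} ∩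
          {ω : BondConfig (Site d) | ∃ x ∈ ({0} : Finset (Site d)), ∃ r ∈ C.2, ∃ v ∈ C.1, ω ∈ openConnIn ((↑C.1 : Set (Site d)) \ ↑(∅ : Finset (Site d))) x v ∧ s(v, r) ∈ ω}))
        (u := fun C => (bondPercolation (zdGraph d) p).real {ω : BondConfig (Site d) | ∃ x ∈ C.2, ∃ t ∈ T',
            ω ∈ openConnIn ((↑W' : Set (Site d)) \ ↑C.1) x t})
        (v := fun C => (bondPercolation (zdGraph d) p).real {ω : BondConfig (Site d) | ∃ x ∈ C.2, ∃ t ∈ T,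
            ω ∈ openConnIn ((↑W : Set (Site d)) \ ↑C.1) x t})
        hQ0 (fun C _ => measureReal_nonneg) hwle (fun C _ => measureReal_nonneg) (fun C _ => measureReal_nonneg)
        (fun C hC _ h => htransfer' C hC h)
        (fun C hC C' hC' hwC hwC' hγC hγC' => by
          have h := hosc C' hC' C hC hwC' hwC (htransfer C' hC' hγC') (htransfer C hC hγC)
          linarith [mul_comm ((bondPercolation (zdGraph d) p).real {ω : BondConfig (Site d) | ∃ x ∈ C.2, ∃ t ∈ T',
            ω ∈ openConnIn ((↑W' : Set (Site d)) \ ↑C.1) x t}) ((bondPercolation (zdGraph d) p).real {ω : BondConfig (Site d) | ∃ x ∈ C'.2, ∃ t ∈ T,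
            ω ∈ openConnIn ((↑W : Set (Site d)) \ ↑C'.1) x t}),
            mul_comm ((bondPercolation (zdGraph d) p).real {ω : BondConfig (Site d) | ∃ x ∈ C'.2, ∃ t ∈ T',
            ω ∈ openConnIn ((↑W' : Set (Site d)) \ ↑C'.1) x t}) ((bondPercolation (zdGraph d) p).real {ω : BondConfig (Site d) | ∃ x ∈ C.2, ∃ t ∈ T,
            ω ∈ openConnIn ((↑W : Set (Site d)) \ ↑C.1) x t})])
    -- sums comparisons
    have hSS : SEn ≤ SUn := Finset.sum_le_sum fun C hC => mul_le_mul_of_nonneg_right (hwle C hC) measureReal_nonneg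
    have hSS' : SEn' ≤ SUn' := Finset.sum_le_sum fun C hC => mul_le_mul_of_nonneg_right (hwle C hC) measureReal_nonneg
    have h0S : 0 ≤ SEn := Finset.sum_nonneg fun C _ => mul_nonneg measureReal_nonneg measureReal_nonneg
    have h0S' : 0 ≤ SEn' := Finset.sum_nonneg fun C _ => mul_nonneg measureReal_nonneg measureReal_nonneg
    have hjn : ϰ₀⁻¹ ^ 2 * μ.real (boxCrossing d (σ (M1 L)) (σ (M2 L))) * μ.real {ω : BondConfig (Site d) | ∃ x ∈ ({0} : Finset (Site d)), ∃ t ∈ T,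
          ω ∈ openConnIn ((↑W : Set (Site d)) \ ↑(∅ : Finset (Site d))) x t} ≤
        ε * μ.real {ω : BondConfig (Site d) | ∃ x ∈ ({0} : Finset (Site d)), ∃ t ∈ T,
          ω ∈ openConnIn ((↑W : Set (Site d)) \ ↑(∅ : Finset (Site d))) x t} :=
      mul_le_mul_of_nonneg_right hη hπn.le
    have hjn' : ϰ₀⁻¹ ^ 2 * μ.real (boxCrossing d (σ (M1 L)) (σ (M2 L))) * μ.real {ω : BondConfig (Site d) | ∃ x ∈ ({0} : Finset (Site d)), ∃ t ∈ T',
          ω ∈ openConnIn ((↑W' : Set (Site d)) \ ↑(∅ : Finset (Site d))) x t} ≤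
        ε * μ.real {ω : BondConfig (Site d) | ∃ x ∈ ({0} : Finset (Site d)), ∃ t ∈ T',
          ω ∈ openConnIn ((↑W' : Set (Site d)) \ ↑(∅ : Finset (Site d))) x t} :=
      mul_le_mul_of_nonneg_right hη hπn'.le
    have key := abs_div_sub_div_le_of_two_sided (V := μ.real (E ∩ {ω : BondConfig (Site d) | ∃ x ∈ ({0} : Finset (Site d)), ∃ t ∈ T,
          ω ∈ openConnIn ((↑W : Set (Site d)) \ ↑(∅ : Finset (Site d))) x t})) (V' := μ.real (E ∩ {ω : BondConfig (Site d) | ∃ x ∈ ({0} : Finset (Site d)), ∃ t ∈ T',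
          ω ∈ openConnIn ((↑W' : Set (Site d)) \ ↑(∅ : Finset (Site d))) x t}))
      (S := SEn) (S' := SEn') (T := SUn) (T' := SUn') hπn hπn' hεpos.le hε1 (hQge L hL)
      ⟨hSU1, hSU2.trans (by linarith)⟩ ⟨hSU1', hSU2'.trans (by linarith)⟩ ⟨hSE1, hSE2.trans (by linarith)⟩
      ⟨hSE1', hSE2'.trans (by linarith)⟩ h0S hSS h0S' hSS' hx1 hx2
    linarith
  refine ⟨τ (M2 0) + 1, by omega, fun W T W' T' h1 h2 h3 h4 h5 h6 h7 h8 => ?_⟩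
  have h := main W T W' T' h1 h2 h3 h4 h5 h6 h7 h8
  rw [cond_zero_eq, cond_zero_eq] at h
  linarith

end Summit.CriticalPhenomena.PercolationContinuityZ3.Theorems.Crossing

end
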